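import Literature.MathematicalPhysics.QuantumLattice.LatticeTori
import HarnessLib

/-!
# Discrete tori: discharge of the long-range-order unfolding lemmas

Sibling proof file of `Literature/MathematicalPhysics/QuantumLattice/LatticeTori.lean`
(topic `MathematicalPhysics/QuantumLattice`). It discharges the two named facts
`hasTorusLRO_iff` and `hasStaggeredTorusLRO_iff` of that file; no statement is introduced or
changed.

* `hasTorusLRO_iff_holds : hasTorusLRO_iff` — `HasTorusLRO G` (long-range order of a family of
  torus two-point functions, implemented as `HasLongRangeOrder` of the pull-back to `ℤ^d` over the
  fundamental domains `halfOpenBox d L`) unfolds to the textbook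
  `0 < liminf_{L → ∞} L^{-2d} Σ_{x, y ∈ (ℤ/Lℤ)^d} G L x y` (Friedli–Velenik 2017, §3.7.2,
  Definition 3.27 / eq. (3.41)).
* `hasStaggeredTorusLRO_iff_holds : hasStaggeredTorusLRO_iff` — the Néel-staggered version,
  signs `(-1)^{Σᵢ xᵢ}` on canonical representatives `xᵢ ∈ {0, …, L - 1}` (Dyson–Lieb–Simon 1978,
  §1, eq. (4), p. 337, with the antiferromagnetic substitution `p ↦ (π, …, π) - p`, p. 338, i.e.
  the sign `(-1)^{|α|}`).

Architecture of the (elementary) proof: for every side `L + 1` the pulled-back double sum over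
`halfOpenBox d (L + 1)` is reindexed along the bijection `Torus.proj (L + 1)`
(`torusProj_bijOn_halfOpenBox`) to a double sum over the torus (`sum_halfOpenBox_comp_torusProj`,
`sum_sq_halfOpenBox_comp_torusProj`); on the fundamental domain the `ℤ^d` sign `latticeStagger`
is the torus sign on canonical representatives (`latticeStagger_eq_of_mem_halfOpenBox`); the
normalisation is `|halfOpenBox d L|² = L^{2d}` (`card_halfOpenBox`); finally the index shift
`L ↦ L + 1` does not change a `liminf` along `atTop` (`Filter.liminf_nat_add`).

## References
* [DysonLiebSimon1978] F. J. Dyson, E. H. Lieb, B. Simon, *Phase transitions in quantum spin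
  systems with isotropic and nonisotropic interactions*, J. Stat. Phys. 18 (1978) 335–383, §1.
* [FriedliVelenik2017] S. Friedli, Y. Velenik, *Statistical Mechanics of Lattice Systems*,
  Cambridge University Press (2017), §3.1, §3.7.2.
-/

noncomputable section

open Filter Finset

namespace Literature.MathematicalPhysics.QuantumLattice

open Literature.Probability.LatticeModels

variable {d : ℕ}

/-! ### The fundamental domain and the torus -/

/-- On the fundamental domain `halfOpenBox d L = {0, …, L-1}^d` the canonical representative of
the `i`-th coordinate of `Torus.proj L x` is `x i` itself: `(Torus.proj L x i).val = |x i|`.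
(Friedli–Velenik 2017, §3.1, periodic boundary condition.) [folklore] -/
theorem val_torusProj_apply_of_mem_halfOpenBox {L : ℕ} [NeZero L] {x : Site d}
    (hx : x ∈ halfOpenBox d L) (i : Fin d) : (Torus.proj L x i).val = (x i).natAbs := by
  rw [mem_halfOpenBox] at hx
  obtain ⟨h0, hL⟩ := hx i
  have h1 : ((Torus.proj L x i).val : ℤ) = x i := by
    rw [Torus.proj_apply, ZMod.val_intCast, Int.emod_eq_of_lt h0 hL]
  have h2 : ((x i).natAbs : ℤ) = x i := Int.natAbs_of_nonneg h0
  exact_mod_cast h1.trans h2.symm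

/-- On the fundamental domain the `ℤ^d` staggering sign `latticeStagger x = (-1)^{Σᵢ |xᵢ|}` is the
torus sign `(-1)^{Σᵢ val (proj x)ᵢ}` computed on canonical representatives.
(Dyson–Lieb–Simon 1978, §1: sign `(-1)^{|α|}`, `αᵢ ∈ {0, …, Lᵢ - 1}`.) [folklore] -/
theorem latticeStagger_eq_of_mem_halfOpenBox {L : ℕ} [NeZero L] {x : Site d}
    (hx : x ∈ halfOpenBox d L) :
    latticeStagger x = (-1 : ℝ) ^ (∑ i, (Torus.proj L x i).val) := by
  simp only [latticeStagger, val_torusProj_apply_of_mem_halfOpenBox hx]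

/-- Reindexing a sum over the torus `(ℤ/Lℤ)^d` (`L ≠ 0`) as a sum over the fundamental domain
`halfOpenBox d L` along the bijection `Torus.proj L` (`torusProj_bijOn_halfOpenBox`).
(Friedli–Velenik 2017, §3.1.) [folklore] -/
theorem sum_halfOpenBox_comp_torusProj {M : Type*} [AddCommMonoid M] {L : ℕ} [NeZero L]
    (φ : TorusSite d L → M) :
    ∑ x ∈ halfOpenBox d L, φ (Torus.proj L x) = ∑ t, φ t := by
  have h := torusProj_bijOn_halfOpenBox (d := d) L
  refine Finset.sum_nbij (Torus.proj L) (fun _ _ => Finset.mem_univ _) h.injOn ?_ (fun _ _ => rfl)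
  rw [Finset.coe_univ]
  exact h.surjOn

/-- Reindexing a double sum over the torus `(ℤ/Lℤ)^d × (ℤ/Lℤ)^d` (`L ≠ 0`) as a double sum over
the fundamental domain along `Torus.proj L` in both variables.
(Friedli–Velenik 2017, §3.1.) [folklore] -/
theorem sum_sq_halfOpenBox_comp_torusProj {M : Type*} [AddCommMonoid M] {L : ℕ} [NeZero L]
    (Φ : TorusSite d L → TorusSite d L → M) :
    ∑ x ∈ halfOpenBox d L, ∑ y ∈ halfOpenBox d L, Φ (Torus.proj L x) (Torus.proj L y) =
      ∑ s, ∑ t, Φ s t := by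
  calc ∑ x ∈ halfOpenBox d L, ∑ y ∈ halfOpenBox d L, Φ (Torus.proj L x) (Torus.proj L y)
      = ∑ x ∈ halfOpenBox d L, ∑ t, Φ (Torus.proj L x) t :=
        Finset.sum_congr rfl fun x _ => sum_halfOpenBox_comp_torusProj (Φ (Torus.proj L x))
    _ = ∑ s, ∑ t, Φ s t := sum_halfOpenBox_comp_torusProj (fun s => ∑ t, Φ s t)

/-- The normalisation: `|halfOpenBox d L|² = L^{2d}` as real numbers (`card_halfOpenBox`).
(Friedli–Velenik 2017, §3.2.) [folklore] -/
theorem card_halfOpenBox_sq_real (L : ℕ) :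
    ((halfOpenBox d L).card : ℝ) ^ 2 = (L : ℝ) ^ (2 * d) := by
  rw [card_halfOpenBox, Nat.cast_pow, ← pow_mul, mul_comm]

/-! ### Long-range order -/

/-- The volume-by-volume identity behind `hasTorusLRO_iff` (side `L + 1 ≠ 0`): the double sum of
the pull-back over the fundamental domain, normalised by `|halfOpenBox d (L+1)|²`, equals the
double sum over the torus `(ℤ/(L+1)ℤ)^d`, normalised by `(L+1)^{2d}`.
(Friedli–Velenik 2017, §3.7.2, eq. (3.41).) [folklore] -/
theorem sum_torusPullback_succ (G : (L : ℕ) → TorusSite d L → TorusSite d L → ℝ) (L : ℕ) :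
    (∑ x ∈ halfOpenBox d (L + 1), ∑ y ∈ halfOpenBox d (L + 1), torusPullback G (L + 1) x y) /
      ((halfOpenBox d (L + 1)).card : ℝ) ^ 2 =
    (∑ x : TorusSite d (L + 1), ∑ y : TorusSite d (L + 1), G (L + 1) x y) /
      ((L + 1 : ℕ) : ℝ) ^ (2 * d) := by
  rw [card_halfOpenBox_sq_real]
  exact congrArg (fun r : ℝ => r / ((L + 1 : ℕ) : ℝ) ^ (2 * d))
    (sum_sq_halfOpenBox_comp_torusProj (G (L + 1)))

/-- **Discharge of `hasTorusLRO_iff`.** `HasTorusLRO G` unfolds to the textbook long-range-order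
criterion `0 < liminf_{L → ∞} L^{-2d} Σ_{x, y ∈ (ℤ/Lℤ)^d} G L x y` (index `L + 1`): the shift
`L ↦ L + 1` does not change a `liminf` along `atTop` (`Filter.liminf_nat_add`), and the two
normalised sums agree for every side `L + 1` (`sum_torusPullback_succ`).
(Friedli–Velenik 2017, §3.7.2, Definition 3.27 / eq. (3.41).)
[cite: FriedliVelenik2017, §3.7.2 Definition 3.27, eq. (3.41)] -/
theorem hasTorusLRO_iff_holds : hasTorusLRO_iff (d := d) := by
  intro G
  have hlim :
      liminf (fun L : ℕ => (∑ x ∈ halfOpenBox d L, ∑ y ∈ halfOpenBox d L,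
          torusPullback G L x y) / ((halfOpenBox d L).card : ℝ) ^ 2) atTop =
      liminf (fun L : ℕ => (∑ x : TorusSite d (L + 1), ∑ y : TorusSite d (L + 1),
          G (L + 1) x y) / ((L + 1 : ℕ) : ℝ) ^ (2 * d)) atTop :=
    (Filter.liminf_nat_add _ 1).symm.trans
      (Filter.liminf_congr (Filter.Eventually.of_forall (sum_torusPullback_succ G)))
  exact Iff.of_eq (congrArg (fun r : ℝ => 0 < r) hlim)

/-- The volume-by-volume identity behind `hasStaggeredTorusLRO_iff` (side `L + 1 ≠ 0`): the
staggered double sum of the pull-back over the fundamental domain, normalised by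
`|halfOpenBox d (L+1)|² = (L+1)^{2d}`, equals the staggered double sum over the torus
`(ℤ/(L+1)ℤ)^d` with signs on canonical representatives, normalised by `(L+1)^{2d}`.
(Dyson–Lieb–Simon 1978, §1, eq. (4) and p. 338.) [folklore] -/
theorem staggeredSum_torusPullback_succ (G : (L : ℕ) → TorusSite d L → TorusSite d L → ℝ)
    (L : ℕ) :
    (∑ x ∈ halfOpenBox d (L + 1), ∑ y ∈ halfOpenBox d (L + 1),
        latticeStagger x * latticeStagger y * torusPullback G (L + 1) x y) /
      ((halfOpenBox d (L + 1)).card : ℝ) ^ 2 =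
    (∑ x : TorusSite d (L + 1), ∑ y : TorusSite d (L + 1),
        (-1 : ℝ) ^ (∑ i, (x i).val) * (-1) ^ (∑ i, (y i).val) * G (L + 1) x y) /
      ((L + 1 : ℕ) : ℝ) ^ (2 * d) := by
  have hnum : (∑ x ∈ halfOpenBox d (L + 1), ∑ y ∈ halfOpenBox d (L + 1),
        latticeStagger x * latticeStagger y * torusPullback G (L + 1) x y) =
      ∑ x : TorusSite d (L + 1), ∑ y : TorusSite d (L + 1),
        (-1 : ℝ) ^ (∑ i, (x i).val) * (-1) ^ (∑ i, (y i).val) * G (L + 1) x y := by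
    calc (∑ x ∈ halfOpenBox d (L + 1), ∑ y ∈ halfOpenBox d (L + 1),
          latticeStagger x * latticeStagger y * torusPullback G (L + 1) x y)
        = ∑ x ∈ halfOpenBox d (L + 1), ∑ y ∈ halfOpenBox d (L + 1),
            (-1 : ℝ) ^ (∑ i, (Torus.proj (L + 1) x i).val) *
              (-1) ^ (∑ i, (Torus.proj (L + 1) y i).val) *
                G (L + 1) (Torus.proj (L + 1) x) (Torus.proj (L + 1) y) := by
          refine Finset.sum_congr rfl fun x hx => Finset.sum_congr rfl fun y hy => ?_
          rw [latticeStagger_eq_of_mem_halfOpenBox hx, latticeStagger_eq_of_mem_halfOpenBox hy,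
            torusPullback_apply]
      _ = _ := sum_sq_halfOpenBox_comp_torusProj (fun s t : TorusSite d (L + 1) =>
            (-1 : ℝ) ^ (∑ i, (s i).val) * (-1) ^ (∑ i, (t i).val) * G (L + 1) s t)
  rw [hnum, card_halfOpenBox_sq_real]

/-- **Discharge of `hasStaggeredTorusLRO_iff`.** `HasStaggeredTorusLRO G` is, by definition,
`HasStaggeredLongRangeOrder` of the pull-back of `G` with sign `latticeStagger` over the
fundamental domains `halfOpenBox d L`; it unfolds to the textbook Néel long-range-order criterion
`0 < liminf_{L → ∞} L^{-2d} Σ_{x, y ∈ (ℤ/Lℤ)^d} (-1)^{Σ xᵢ} (-1)^{Σ yᵢ} G L x y` (index `L + 1`),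
which is Dyson–Lieb–Simon's eq. (4) of §1 (p. 337) with the antiferromagnetic substitution
`p ↦ (π, …, π) - p` (p. 338), i.e. the sign `(-1)^{|α|}` on `αᵢ ∈ {0, …, Lᵢ - 1}`. Proof: the shift
`L ↦ L + 1` does not change a `liminf` along `atTop` (`Filter.liminf_nat_add`), and the two
normalised sums agree for every side `L + 1` (`staggeredSum_torusPullback_succ`).
[cite: DysonLiebSimon1978, §1 eq. (4), pp. 337–338] -/
theorem hasStaggeredTorusLRO_iff_holds : hasStaggeredTorusLRO_iff (d := d) := by
  intro G
  have hlim :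
      liminf (fun L : ℕ => (∑ x ∈ halfOpenBox d L, ∑ y ∈ halfOpenBox d L,
          latticeStagger x * latticeStagger y * torusPullback G L x y) /
        ((halfOpenBox d L).card : ℝ) ^ 2) atTop =
      liminf (fun L : ℕ => (∑ x : TorusSite d (L + 1), ∑ y : TorusSite d (L + 1),
          (-1 : ℝ) ^ (∑ i, (x i).val) * (-1) ^ (∑ i, (y i).val) * G (L + 1) x y) /
        ((L + 1 : ℕ) : ℝ) ^ (2 * d)) atTop :=
    (Filter.liminf_nat_add _ 1).symm.trans
      (Filter.liminf_congr (Filter.Eventually.of_forall (staggeredSum_torusPullback_succ G)))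
  exact Iff.of_eq (congrArg (fun r : ℝ => 0 < r) hlim)

end Literature.MathematicalPhysics.QuantumLattice
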